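import Literature.MathematicalPhysics.QuantumFieldTheory.Balaban1983to89.T4GlobalDenominator
import Literature.MathematicalPhysics.QuantumFieldTheory.Balaban1983to89.T4PersistentHistoryCount

/-!
# `Balaban1983to89.T4LiveStructureGas` — (G4) of `T4GlobalDenominator.GlobalDom` over the LIVE index set: the
live-structure subset gas in the records currency of `T4PersistentHistoryCount` (cell `pub-balaban`, T4-DAG §5 row
T4-U5c.E-NE7b-LIVEGAS-K* (self-row, §8 Q24(a)), node U5c / U5.E, spine estimate NE7b, COUNT member P1; kernel
bookkeeping — finite combinatorics + real arithmetic, imports `T4GlobalDenominator` (renewal member t4-ne7b-p2, v1.1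
p188002) and `T4PersistentHistoryCount` (this lineage, v1.4 p187914) BY NAME and modifies nothing)

HONEST FRAMING (T4-DAG PAGE 1).  The cell's T4 target is the existence and uniqueness of the `ε → 0` limit of unit-scale
block-averaged expectations on a FIXED finite torus, at rung (B)+1, CONDITIONAL on Bałaban's ultraviolet stability (B)
and on BetaPertH; it is NOT infinite volume, NOT the mass gap, NOT the Clay problem.  This module is [folklore] finite
combinatorics and real analysis.  NOTHING of Bałaban's is asserted: no sentence of [Balaban1989LargeFieldII] (cell paper
B16, CMP 122 (1989) 355–392) or of [Balaban1988Convergent] (B14, CMP 119 (1988) 243–285) is quoted or typed here; the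
per-record PRICE majorant below (hypothesis `hy`, the shape of `T4PersistentHistoryCount.slotPrice_le`'s `hy`) is the
cell's located-unprinted analytic input (GAPS G-ne7bp1-1; under the global-denominator re-typing it is the content of
(G3) = R1 banked re-cut + R3′ per-live-term reading + the (ID) dictionary, RULING R-GD-1 of the U5 referee, journal
2026-08-19T12:54:19Z) and is NOT discharged here.  Value = a kernel certificate, in `GlobalDom`'s own currency, of the
docket item «(G4) over the LIVE index set (ne7b-p1's records carrier + window budget)» of RULING R-GD-1; NOT an estimate
of Bałaban's expansion; NOT summit progress; NOT a proof of NE7b.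

THE POINT.  `T4GlobalDenominator.relWeightBound_of_globalDom` closes node U5c's weight slot at FIXED volume from, per run,
(G2) a global lower bound, (G3) ABSOLUTE per-term bounds `A K t τ ≤ F K τ · nup K t` on the bad class with a history
factor `F`, (G5) comparable normalisations — packaged as `GlobalDom` — plus the MODEL ENTROPY SUM
(G4) `Σ_{τ ∈ Bad K t} F K τ ≤ M K` with `Σ_K M K < ∞`.  This lineage's count verdict (journal 2026-08-19T12:49:08Z;
kernel `T4PersistentHistoryCount` v1.4 §12 `allAges_birthBudget_unbounded`) is that (G4) is K-uniformly summable only if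
`F`'s index is the LIVE index set at step `K` — the structures still pending at the cutoff, each with its record — and
NOT the set of all past large-field regions (an all-ages birth-only budget diverges with `K` even at fixed volume).  This
module types the live index set and PROVES (G4) over it, in the records currency:
  §1 THE SUBSET GAS.  A finite slot universe `U` with prices `q ≥ 0` and an old part `O ⊆ U`; a FAMILY `S ⊆ U` weighs
     `famWeight q S = ∏_{s ∈ S} q s`.  Total mass `Σ_{S ⊆ U} famWeight q S = ∏_{s ∈ U} (1 + q s)` (`Finset.prod_one_add`);
     the families through a given slot `o` weigh `q o · ∏_{U ∖ o} (1 + q)` (`Finset.sum_powerset_insert`); hence the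
     UNION BOUND: the families meeting `O` weigh at most `(Σ_{o ∈ O} q o) · ∏_{s ∈ U} (1 + q s) ≤ (Σ_O q) · exp (Σ_U q)`
     (`sum_bad_famWeight_le`, `sum_bad_famWeight_le_mul_exp`) — the absolute twin, at the level of FAMILIES of live
     structures, of the product-gas bound `T4GlobalDenominator.sum_bad_gasWeight_le_mul_exp` (one value per slot) and of the
     relative same-family bound `T4PeierlsDomination.sum_bad_le_weight_mul_total`.
  §2 TRANSFER TO TERMS.  Terms `τ ∈ Bad` labelled INJECTIVELY by their live family `str τ ⊆ U` meeting `O`, history factor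
     `F τ = famWeight q (str τ)` ⇒ `Σ_{Bad} F ≤ (Σ_O q) · exp (Σ_U q)` (`sum_bad_historyFactor_le_mul_exp`); the
     `K`-indexed form `entropySum_of_liveGas` is (G4) with `M K = mold K · exp (mlive K)` from ANY majorants
     `Σ_{O K} q K ≤ mold K` (old mass) and `Σ_{U K} q K ≤ mlive K` (live mass).
  §3 THE RECORDS INSTANCE (the live index set of the persistence count, typed): slots of cutoff `K` = (birth step
     `j ≤ K`, birth cell `z ∈ Cell K (K − j)` with `#Cell K a ≤ V·Λ^a`, birth kind `b ∈ B K j`, record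
     `Q ∈ records W j K (E K j) b`) — `liveSlots`; old slots = births `j < j⋆ K` — `oldSlots ⊆ liveSlots`; prices
     `y K j z b Q ≥ 0` under the per-record majorant `y ≤ ρ b · e^{−κ₁ W b} · ∏_{e ∈ Q} (e^{−κ₁ W e} · η e)` with
     `Σ_b ρ ≤ ρ̄`, per-step residual entropy `≤ η̄`, `σ := e^{η̄ − κ₁}`, `Λσ < 1`.  Then the LIVE MASS is `K`-UNIFORM,
     `Σ_{liveSlots K} y ≤ ρ̄ e^{−κ₁} · V / (1 − Λσ)` (`liveMass_le`: `slotPrice_le` per slot, cells `V Λ^a`, the age sum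
     `Σ_{a ≤ K} (Λσ)^a ≤ 1/(1 − Λσ)` — young AND old context in ONE currency, no window multiplicity), and the OLD MASS is
     geometric, `Σ_{oldSlots K} y ≤ ρ̄ e^{−κ₁} · V · (Λσ)^{K − j⋆ K + 1}/(1 − Λσ)` (`oldMass_le` = this lineage's
     `oldSlotBudget_le`); the budget `recordsBudget` is summable in `K` as soon as a positive fraction of the steps is old,
     `c·K ≤ K − j⋆ K` (`summable_recordsBudget`, via `T4WeightBudget.summable_weightMajorant`).
  §4 COMPOSITION BY NAME with `T4GlobalDenominator.exists_relWeightBound_of_globalDom`: two runs `GlobalDom` whose history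
     factors are DOMINATED on the bad class by live-gas factors (`globalDom_mono_historyFactor`: (G3) is monotone in the
     history factor, so resummation factors of the dead past riding on the per-structure price are absorbed) ⇒ `∃ K₁ ≥ K₀, RelWeightBound` with the bad classes emptied
     below `K₁` and `W = 𝟙_{K ≥ K₁} · C · M` (`exists_relWeightBound_of_liveGas`, abstract majorants;
     `exists_relWeightBound_of_recordsGas`, the records instance with `M = recordsBudget`).  No relative, conditional or
     territory-local comparison and no context-uniformity clause is among the hypotheses: under (GD) the count member's
     carrier needs the price majorant in ABSOLUTE currency only.
  §5 THE CONTRAST, by name.  If instead every age class `a ≤ K` is priced birth-only with a credit of (2.7)-growth (no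
     `κ₁` per step of age), the live-mass majorant is the divergent budget of
     `T4PersistentHistoryCount.allAges_birthBudget_unbounded`, so the context factor `exp (live mass)` is NOT `K`-uniform
     (`contextFactor_unbounded_of_birthOnly`): the per-step credit `κ₁` of the records currency — birth credit
     `≥ κ₁ · W b` over the birth window (`credit_dominates_window`), then `κ₁` per waited step paid by the events — is
     exactly what makes `exp (live mass)` a constant `e^{vol·B}` at fixed volume.
  §6 Sanity: a two-slot gas inhabiting §1 non-vacuously (old part non-empty, bound checked numerically), and the
     records budget at concrete constants.
INDEX LEVEL.  Everything is stated over an ARBITRARY index type `ι`; the one structural hypothesis is the INJECTIVE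
labelling of bad indices by live families (`hinj`).  It holds by construction when `ι` = the LIVE CLASSES of cutoff `K`
(a class = a family of pending structures with their records) — the level at which RULING R-GD-1 runs (G3)/(G4) («per
live term», «over the live index set») — and NOT for raw expansion terms, where distinct dead pasts share a live family;
the passage classes → terms is the renewal member's class-fibration pushforward of `RelWeightBound` (t4-ne7b-p2 gen 7,
journal CLAIM 2026-08-19T13:27:44Z, provisional leaf; exact, by `Finset.sum_fiberwise`), with the dead past's resummation
factor riding on the per-structure price — absorbed here by `globalDom_mono_historyFactor`.  The two leaves compose BY
NAME and neither imports the other's unlanded text.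
Precision of this lineage's journal sentence 2026-08-19T12:49:08Z «M_K = M_K^{old} · exp(vol·B_young)»: in one currency
the context factor is `exp (live mass)` with live mass `≥` the young window budget and still `K`-uniform; `M K` =
(old mass) × (context factor).  WHAT THIS DOES NOT DO: it does not touch (G2) ((B)'s lower half, the `χ_K`-constrained
unit-lattice integral), (G5), or the derivation of (G3)'s absolute per-live-term bounds from [Balaban1989LargeFieldII]
(1.79)–(1.89) with the resummed past absorbed in `nup` (R1 + R3′ + (ID)) — those are the instantiating seat's and the
E2-rel owners'; the wall G-ne7bp1-1 is neither narrowed nor widened (relocated under (GD) as booked in T4-DAG §6 NE7b).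

References (locators only, nothing quoted): [Balaban1989LargeFieldII] Thm 1 (0.1) p. 355, (1.79) p. 383, (1.80) p. 384,
(1.85)–(1.89) pp. 385–388, (1.104) p. 391; [Balaban1988Convergent] (2.7) p. 255, Cor. 3 (2.50) p. 264 — as read in
`T4GlobalDenominator` / `T4PersistentHistoryCount` / `FINAL-STATEMENT.md` §1, §5 (f).
-/

open Finset _root_.Filter _root_.Topology

namespace Literature.MathematicalPhysics.QuantumFieldTheory.Balaban1983to89.T4LiveStructureGas

open Literature.MathematicalPhysics.QuantumFieldTheory.Balaban1983to89
open T4WeightBudget T4GlobalDenominator T4PersistentHistoryCount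

/-! ## §1 The subset gas: families of live structures, total mass, union bound -/

section SubsetGas

variable {σ : Type*}

/-- The weight of a FAMILY of live structures: the product of the slot prices over the family. [folklore] -/
def famWeight (q : σ → ℝ) (S : Finset σ) : ℝ := ∏ s ∈ S, q s

/-- the empty family weighs `1` (the no-live-structure term) [folklore] -/
@[simp] theorem famWeight_empty (q : σ → ℝ) : famWeight q ∅ = 1 := by simp [famWeight]

/-- family weights are nonnegative for prices nonnegative on the family [folklore] -/
theorem famWeight_nonneg {q : σ → ℝ} {S : Finset σ} (hq : ∀ s ∈ S, 0 ≤ q s) : 0 ≤ famWeight q S :=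
  Finset.prod_nonneg hq

/-- **TOTAL MASS OF THE SUBSET GAS** `= ∏_{s ∈ U} (1 + q s)`: the families are counted EXACTLY as the subsets of the
slot universe (`Finset.prod_one_add`). [folklore] -/
theorem sum_powerset_famWeight_eq (U : Finset σ) (q : σ → ℝ) :
    ∑ S ∈ U.powerset, famWeight q S = ∏ s ∈ U, (1 + q s) := by
  unfold famWeight; rw [Finset.prod_one_add]

variable [DecidableEq σ]

/-- adjoining a new slot multiplies the weight by its price [folklore] -/
theorem famWeight_insert (q : σ → ℝ) {o : σ} {S : Finset σ} (ho : o ∉ S) :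
    famWeight q (insert o S) = q o * famWeight q S := by
  unfold famWeight; rw [Finset.prod_insert ho]

/-- **THE MASS THROUGH ONE SLOT**: the families `S ⊆ U` containing a given slot `o ∈ U` weigh exactly
`q o · ∏_{s ∈ U ∖ o} (1 + q s)` (split `U = insert o (U.erase o)`, `Finset.sum_powerset_insert`). [folklore] -/
theorem sum_powerset_filter_mem_famWeight_eq (U : Finset σ) (q : σ → ℝ) {o : σ} (ho : o ∈ U) :
    ∑ S ∈ U.powerset with o ∈ S, famWeight q S = q o * ∏ s ∈ U.erase o, (1 + q s) := by
  have hne : o ∉ U.erase o := Finset.notMem_erase o U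
  rw [Finset.sum_filter, ← Finset.insert_erase ho, Finset.sum_powerset_insert hne]
  have h1 : ∑ S ∈ (U.erase o).powerset, (if o ∈ S then famWeight q S else 0) = 0 :=
    Finset.sum_eq_zero fun S hS => if_neg fun hoS => hne (Finset.mem_powerset.1 hS hoS)
  have h2 : ∑ S ∈ (U.erase o).powerset, (if o ∈ insert o S then famWeight q (insert o S) else 0)
      = q o * ∏ s ∈ U.erase o, (1 + q s) := by
    rw [← sum_powerset_famWeight_eq, Finset.mul_sum]
    refine Finset.sum_congr rfl fun S hS => ?_
    rw [if_pos (Finset.mem_insert_self o S),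
      famWeight_insert q fun hoS => hne (Finset.mem_powerset.1 hS hoS)]
  rw [h1, h2, zero_add, Finset.insert_erase ho]

/-- … hence at most `q o · ∏_{s ∈ U} (1 + q s)` for nonnegative prices (the dropped factor is `1 + q o ≥ 1`). [folklore] -/
theorem sum_powerset_filter_mem_famWeight_le (U : Finset σ) {q : σ → ℝ} (hq : ∀ s ∈ U, 0 ≤ q s) {o : σ}
    (ho : o ∈ U) : ∑ S ∈ U.powerset with o ∈ S, famWeight q S ≤ q o * ∏ s ∈ U, (1 + q s) := by
  rw [sum_powerset_filter_mem_famWeight_eq U q ho]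
  refine mul_le_mul_of_nonneg_left ?_ (hq o ho)
  rw [← Finset.mul_prod_erase U (fun s => 1 + q s) ho]
  exact le_mul_of_one_le_left (Finset.prod_nonneg fun s hs => by linarith [hq s (Finset.mem_of_mem_erase hs)])
    (by linarith [hq o ho])

/-- **THE UNION BOUND FOR THE BAD FAMILIES.**  If every bad family is a sub-family of `U` meeting the old part `O ⊆ U`,
then for nonnegative prices `Σ_{Bad} famWeight q ≤ (Σ_{o ∈ O} q o) · ∏_{s ∈ U} (1 + q s)` — (old mass) × (total mass).
[folklore] -/
theorem sum_bad_famWeight_le (U O : Finset σ) (hO : O ⊆ U) {q : σ → ℝ} (hq : ∀ s ∈ U, 0 ≤ q s)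
    {Bad : Finset (Finset σ)} (hBad : ∀ S ∈ Bad, S ⊆ U ∧ ∃ o ∈ O, o ∈ S) :
    ∑ S ∈ Bad, famWeight q S ≤ (∑ o ∈ O, q o) * ∏ s ∈ U, (1 + q s) := by
  have hnn : ∀ S ∈ Bad, 0 ≤ famWeight q S := fun S hS => famWeight_nonneg fun s hs => hq s ((hBad S hS).1 hs)
  calc ∑ S ∈ Bad, famWeight q S
      ≤ ∑ S ∈ Bad, ∑ o ∈ O, (if o ∈ S then famWeight q S else 0) := by
        refine Finset.sum_le_sum fun S hS => ?_
        obtain ⟨-, o, hoO, hoS⟩ := hBad S hS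
        calc famWeight q S = (if o ∈ S then famWeight q S else 0) := (if_pos hoS).symm
          _ ≤ ∑ o' ∈ O, (if o' ∈ S then famWeight q S else 0) :=
            Finset.single_le_sum (f := fun o' => if o' ∈ S then famWeight q S else 0)
              (fun o' _ => by
                show 0 ≤ (if o' ∈ S then famWeight q S else 0)
                split_ifs
                exacts [hnn S hS, le_rfl]) hoO
    _ = ∑ o ∈ O, ∑ S ∈ Bad, (if o ∈ S then famWeight q S else 0) := Finset.sum_comm
    _ = ∑ o ∈ O, ∑ S ∈ Bad with o ∈ S, famWeight q S := by simp only [Finset.sum_filter]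
    _ ≤ ∑ o ∈ O, ∑ S ∈ U.powerset with o ∈ S, famWeight q S := by
        refine Finset.sum_le_sum fun o _ =>
          Finset.sum_le_sum_of_subset_of_nonneg (fun S hS => ?_) fun S hS _ => ?_
        · obtain ⟨hSB, hoS⟩ := Finset.mem_filter.1 hS
          exact Finset.mem_filter.2 ⟨Finset.mem_powerset.2 (hBad S hSB).1, hoS⟩
        · exact famWeight_nonneg fun s hs => hq s (Finset.mem_powerset.1 (Finset.mem_filter.1 hS).1 hs)
    _ ≤ ∑ o ∈ O, q o * ∏ s ∈ U, (1 + q s) :=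
        Finset.sum_le_sum fun o ho => sum_powerset_filter_mem_famWeight_le U hq (hO ho)
    _ = (∑ o ∈ O, q o) * ∏ s ∈ U, (1 + q s) := by rw [Finset.sum_mul]

/-- **… × exp(LIVE MASS).**  `∏_{s ∈ U} (1 + q s) ≤ exp (Σ_{s ∈ U} q s)`, so the bad families weigh at most
(old mass) · `exp` (live mass). [folklore] -/
theorem sum_bad_famWeight_le_mul_exp (U O : Finset σ) (hO : O ⊆ U) {q : σ → ℝ} (hq : ∀ s ∈ U, 0 ≤ q s)
    {Bad : Finset (Finset σ)} (hBad : ∀ S ∈ Bad, S ⊆ U ∧ ∃ o ∈ O, o ∈ S) :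
    ∑ S ∈ Bad, famWeight q S ≤ (∑ o ∈ O, q o) * Real.exp (∑ s ∈ U, q s) :=
  (sum_bad_famWeight_le U O hO hq hBad).trans
    (mul_le_mul_of_nonneg_left (T4PersistentHistoryCount.prod_one_add_le_exp_sum hq)
      (Finset.sum_nonneg fun o ho => hq o (hO ho)))

end SubsetGas

/-! ## §2 Transfer to the term language of `GlobalDom`: injective labelling by live families -/

section Transfer

variable {ι σ : Type*} [DecidableEq σ]

/-- **TERMS LABELLED BY THEIR LIVE FAMILIES.**  If the bad terms `τ ∈ Bad` carry live families `str τ ⊆ U` meeting the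
old part `O ⊆ U`, DISTINCT bad terms having distinct families (`Set.InjOn str Bad` — true BY CONSTRUCTION at the level
where (GD) is run, the LIVE CLASSES (a class = a family of pending structures with their records; the renewal member's
class fibration pushes `RelWeightBound` forward from classes to raw terms exactly); NOT true at raw-term level, where
distinct dead pasts share a live family — there the dead past rides on the PRICE, `globalDom_mono_historyFactor`), then
the history factors `famWeight q (str τ)` have entropy sum at most (old mass) · `exp` (live mass). [folklore] -/
theorem sum_bad_historyFactor_le_mul_exp (U O : Finset σ) (hO : O ⊆ U) {q : σ → ℝ} (hq : ∀ s ∈ U, 0 ≤ q s)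
    {Bad : Finset ι} (str : ι → Finset σ) (hinj : Set.InjOn str Bad)
    (hstr : ∀ τ ∈ Bad, str τ ⊆ U ∧ ∃ o ∈ O, o ∈ str τ) :
    ∑ τ ∈ Bad, famWeight q (str τ) ≤ (∑ o ∈ O, q o) * Real.exp (∑ s ∈ U, q s) := by
  classical
  rw [← Finset.sum_image hinj (f := famWeight q)]
  refine sum_bad_famWeight_le_mul_exp U O hO hq fun S hS => ?_
  obtain ⟨τ, hτ, rfl⟩ := Finset.mem_image.1 hS
  exact hstr τ hτ

/-- **DOMINATED HISTORY FACTORS.**  A run satisfying `GlobalDom` with history factors `F` satisfies it with any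
LARGER factors `F'` on the bad class (from `K₀` on, `|t| ≤ l₀`): (G3) `A ≤ F·nup ≤ F'·nup` since `nup ≥ 0`, and
`0 ≤ F ≤ F'`.  This is the socket by which a history factor of the shape (live-family price) × (resummation factor of the
dead past riding on the price, per structure) is replaced by a live-gas factor `famWeight q' (str τ)` with enlarged slot
prices. [folklore] -/
theorem globalDom_mono_historyFactor {l₀ : ℝ} {K₀ : ℕ} {T : ℕ → Finset ι} {A : ℕ → ℝ → ι → ℝ}
    {Bad : ℕ → ℝ → Finset ι} {F F' : ℕ → ι → ℝ} {nlow nup : ℕ → ℝ → ℝ} {C : ℝ}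
    (h : GlobalDom l₀ T A Bad F nlow nup C K₀)
    (hle : ∀ K t, |t| ≤ l₀ → K₀ ≤ K → ∀ τ ∈ Bad K t, F K τ ≤ F' K τ) :
    GlobalDom l₀ T A Bad F' nlow nup C K₀ where
  bad_subset := h.bad_subset
  low := h.low
  up K t ht hK τ hτ := (h.up K t ht hK τ hτ).trans
    (mul_le_mul_of_nonneg_right (hle K t ht hK τ hτ) (h.nup_nonneg K t ht hK))
  F_nonneg K t ht hK τ hτ := (h.F_nonneg K t ht hK τ hτ).trans (hle K t ht hK τ hτ)
  nup_nonneg := h.nup_nonneg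
  ratio := h.ratio

/-- **(G4) OVER THE LIVE INDEX SET, ABSTRACT MAJORANTS.**  Per cutoff `K`: slot universe `U K`, old part `O K ⊆ U K`,
prices `q K ≥ 0` on `U K`, bad terms (for `|t| ≤ l₀`, `K ≥ K₀`) labelled injectively by live families in `U K` meeting
`O K`; majorants `Σ_{O K} q K ≤ mold K` and `Σ_{U K} q K ≤ mlive K`.  Then the (G4) hypothesis of
`T4GlobalDenominator.relWeightBound_of_globalDom` holds with `M K = mold K · exp (mlive K)`. [folklore] -/
theorem entropySum_of_liveGas {l₀ : ℝ} {K₀ : ℕ} {Bad : ℕ → ℝ → Finset ι} (U O : ℕ → Finset σ)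
    (hO : ∀ K, O K ⊆ U K) (q : ℕ → σ → ℝ) (hq : ∀ K, ∀ s ∈ U K, 0 ≤ q K s) (str : ℕ → ι → Finset σ)
    (hinj : ∀ K t, |t| ≤ l₀ → K₀ ≤ K → Set.InjOn (str K) (Bad K t))
    (hstr : ∀ K t, |t| ≤ l₀ → K₀ ≤ K → ∀ τ ∈ Bad K t, str K τ ⊆ U K ∧ ∃ o ∈ O K, o ∈ str K τ)
    {mold mlive : ℕ → ℝ} (hold : ∀ K, K₀ ≤ K → ∑ o ∈ O K, q K o ≤ mold K)
    (hlive : ∀ K, K₀ ≤ K → ∑ s ∈ U K, q K s ≤ mlive K) :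
    ∀ K t, |t| ≤ l₀ → K₀ ≤ K →
      ∑ τ ∈ Bad K t, famWeight (q K) (str K τ) ≤ mold K * Real.exp (mlive K) := by
  intro K t ht hK
  have hold0 : 0 ≤ ∑ o ∈ O K, q K o := Finset.sum_nonneg fun o ho => hq K o (hO K ho)
  calc ∑ τ ∈ Bad K t, famWeight (q K) (str K τ)
      ≤ (∑ o ∈ O K, q K o) * Real.exp (∑ s ∈ U K, q K s) :=
        sum_bad_historyFactor_le_mul_exp (U K) (O K) (hO K) (hq K) (str K) (hinj K t ht hK) (hstr K t ht hK)
    _ ≤ mold K * Real.exp (mlive K) :=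
        mul_le_mul (hold K hK) (Real.exp_le_exp.2 (hlive K hK)) (Real.exp_pos _).le (hold0.trans (hold K hK))

/-- **§4 (abstract form) COMPOSITION WITH THE EXTRACTION.**  Two runs satisfying `GlobalDom` from `K₀` on whose history
factors `F`, `G` are DOMINATED on the bad class by the live-gas factors `famWeight (q K) (str K τ)` (the instantiating seat
proves (G3) in that shape: each bad term is at most the product of its live structures' record prices — resummation
factors of the dead past included in the prices — times the normalisation), the live-gas data of `entropySum_of_liveGas`
with `mold ≥ 0`, and a SUMMABLE budget `M K = mold K · exp (mlive K)` ⇒ SOME `RelWeightBound` (bad classes emptied below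
a threshold `K₁ ≥ K₀`, `W = 𝟙_{K ≥ K₁} · C · M`) — by `globalDom_mono_historyFactor` and
`T4GlobalDenominator.exists_relWeightBound_of_globalDom`, binder for binder. [folklore] -/
theorem exists_relWeightBound_of_liveGas {l₀ : ℝ} {K₀ : ℕ} {T : ℕ → Finset ι} {A B : ℕ → ℝ → ι → ℝ}
    {Bad : ℕ → ℝ → Finset ι} {F G : ℕ → ι → ℝ} {nlow nup mlow mup : ℕ → ℝ → ℝ} {C : ℝ} (U O : ℕ → Finset σ)
    (hO : ∀ K, O K ⊆ U K) (q : ℕ → σ → ℝ) (hq : ∀ K, ∀ s ∈ U K, 0 ≤ q K s) (str : ℕ → ι → Finset σ)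
    (hinj : ∀ K t, |t| ≤ l₀ → K₀ ≤ K → Set.InjOn (str K) (Bad K t))
    (hstr : ∀ K t, |t| ≤ l₀ → K₀ ≤ K → ∀ τ ∈ Bad K t, str K τ ⊆ U K ∧ ∃ o ∈ O K, o ∈ str K τ)
    {mold mlive : ℕ → ℝ} (hmold0 : ∀ K, 0 ≤ mold K) (hold : ∀ K, K₀ ≤ K → ∑ o ∈ O K, q K o ≤ mold K)
    (hlive : ∀ K, K₀ ≤ K → ∑ s ∈ U K, q K s ≤ mlive K)
    (hMs : Summable fun K => mold K * Real.exp (mlive K))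
    (hA : GlobalDom l₀ T A Bad F nlow nup C K₀) (hB : GlobalDom l₀ T B Bad G mlow mup C K₀)
    (hF : ∀ K t, |t| ≤ l₀ → K₀ ≤ K → ∀ τ ∈ Bad K t, F K τ ≤ famWeight (q K) (str K τ))
    (hG : ∀ K t, |t| ≤ l₀ → K₀ ≤ K → ∀ τ ∈ Bad K t, G K τ ≤ famWeight (q K) (str K τ)) (hC : 0 ≤ C) :
    ∃ K₁, K₀ ≤ K₁ ∧ RelWeightBound l₀ T A B (fun K t => if K₁ ≤ K then Bad K t else ∅)
      (Set.indicator {K | K₁ ≤ K} (fun K => C * (mold K * Real.exp (mlive K)))) :=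
  have hE := entropySum_of_liveGas U O hO q hq str hinj hstr hold hlive
  exists_relWeightBound_of_globalDom (globalDom_mono_historyFactor hA hF) (globalDom_mono_historyFactor hB hG) hC
    (fun K => mul_nonneg (hmold0 K) (Real.exp_pos _).le) hE hE hMs

end Transfer

/-! ## §3 The records instance: the live index set of the persistence count, its K-uniform live mass, its geometric
old mass -/

section Records

variable {γ ε : Type*}

/-- The type of LIVE SLOTS of the persistence count: (birth step, birth cell, birth kind, record). [folklore] -/
abbrev Slot (γ ε : Type*) : Type _ := Σ _ : ℕ, Σ _ : γ, Σ _ : ε, Finset ε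

/-- **THE LIVE INDEX SET AT CUTOFF `K`** (typed): births `j ≤ K` (age `K − j`), cells `z ∈ Cell K (K − j)`, birth kinds
`b ∈ B K j`, records `Q ∈ records W j K (E K j) b` — every structure still pending at `K`, young or old, with its history;
NO region that was born and integrated out before `K` (print's resummed past belongs to the normalisation). [folklore] -/
def liveSlots (Cell : ℕ → ℕ → Finset γ) (W : ε → ℕ) (E B : ℕ → ℕ → Finset ε) (K : ℕ) : Finset (Slot γ ε) :=
  (range (K + 1)).sigma fun j => (Cell K (K - j)).sigma fun _ => (B K j).sigma fun b => records W j K (E K j) b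

/-- **THE OLD PART**: the live slots born before the matching scale `j⋆ K` (ages `> K − j⋆ K`). [folklore] -/
def oldSlots (Cell : ℕ → ℕ → Finset γ) (W : ε → ℕ) (E B : ℕ → ℕ → Finset ε) (jstar : ℕ → ℕ) (K : ℕ) :
    Finset (Slot γ ε) :=
  (range (jstar K)).sigma fun j => (Cell K (K - j)).sigma fun _ => (B K j).sigma fun b => records W j K (E K j) b

/-- old slots are live slots (`j⋆ K ≤ K`) [folklore] -/
theorem oldSlots_subset_liveSlots (Cell : ℕ → ℕ → Finset γ) (W : ε → ℕ) (E B : ℕ → ℕ → Finset ε)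
    {jstar : ℕ → ℕ} {K : ℕ} (hj : jstar K ≤ K) :
    oldSlots Cell W E B jstar K ⊆ liveSlots Cell W E B K := by
  intro s hs
  simp only [oldSlots, liveSlots, Finset.mem_sigma, Finset.mem_range] at hs ⊢
  exact ⟨by omega, hs.2⟩

/-- sums over the live slots are the iterated sums over (birth, cell, kind, record) [folklore] -/
theorem sum_liveSlots_eq (Cell : ℕ → ℕ → Finset γ) (W : ε → ℕ) (E B : ℕ → ℕ → Finset ε) (K : ℕ)
    (f : Slot γ ε → ℝ) :
    ∑ s ∈ liveSlots Cell W E B K, f s =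
      ∑ j ∈ range (K + 1), ∑ z ∈ Cell K (K - j), ∑ b ∈ B K j, ∑ Q ∈ records W j K (E K j) b, f ⟨j, z, b, Q⟩ := by
  simp only [liveSlots, Finset.sum_sigma]

/-- … and likewise over the old slots [folklore] -/
theorem sum_oldSlots_eq (Cell : ℕ → ℕ → Finset γ) (W : ε → ℕ) (E B : ℕ → ℕ → Finset ε) (jstar : ℕ → ℕ) (K : ℕ)
    (f : Slot γ ε → ℝ) :
    ∑ s ∈ oldSlots Cell W E B jstar K, f s =
      ∑ j ∈ range (jstar K), ∑ z ∈ Cell K (K - j), ∑ b ∈ B K j, ∑ Q ∈ records W j K (E K j) b, f ⟨j, z, b, Q⟩ := by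
  simp only [oldSlots, Finset.sum_sigma]

/-- The record price of a slot, as a function on `Slot`. [folklore] -/
def slotPrice (y : ℕ → γ → ε → Finset ε → ℝ) (s : Slot γ ε) : ℝ := y s.1 s.2.1 s.2.2.1 s.2.2.2

/-- the price of the slot `⟨j, z, b, Q⟩` is `y j z b Q` [folklore] -/
@[simp] theorem slotPrice_mk (y : ℕ → γ → ε → Finset ε → ℝ) (j : ℕ) (z : γ) (b : ε) (Q : Finset ε) :
    slotPrice y ⟨j, z, b, Q⟩ = y j z b Q := rfl

/-- the age sum of the two-rate profile over ALL ages `≤ K` is at most `1/(1 − r)` (`0 ≤ r < 1`) — `K`-UNIFORM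
[folklore] -/
theorem sum_range_succ_pow_sub_le {r : ℝ} (h0 : 0 ≤ r) (h1 : r < 1) (K : ℕ) :
    ∑ j ∈ range (K + 1), r ^ (K - j) ≤ 1 / (1 - r) := by
  have h := Finset.sum_range_reflect (fun i => r ^ i) (K + 1)
  simp only [Nat.add_sub_cancel] at h
  rw [h, one_div]
  calc ∑ i ∈ range (K + 1), r ^ i ≤ ∑' i, r ^ i :=
        (summable_geometric_of_lt_one h0 h1).sum_le_tsum _ fun i _ => pow_nonneg h0 i
    _ = (1 - r)⁻¹ := tsum_geometric_of_lt_one h0 h1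

/-- **THE LIVE MASS IS `K`-UNIFORM.**  Under the per-record price majorant (the `hy` of
`T4PersistentHistoryCount.slotPrice_le`, here for EVERY birth step `j ≤ K` — young structures included: a structure of age
`a` pays `κ₁` per step of age out of its birth window and its events' windows) and `#Cell K a ≤ V·Λ^a`,
`Σ_{liveSlots K} y ≤ ρ̄ e^{−κ₁} · V · 1/(1 − Λσ)`, `σ = e^{η̄ − κ₁}`, for every `K`.  No window multiplicity, no
all-ages birth budget. [folklore] -/
theorem liveMass_le [DecidableEq ε] (Cell : ℕ → ℕ → Finset γ) {V Λ : ℝ} (hV : 0 ≤ V) (hΛ : 0 ≤ Λ)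
    (hcell : ∀ K a, ((Cell K a).card : ℝ) ≤ V * Λ ^ a) (W : ε → ℕ) (step : ε → ℕ) (E B : ℕ → ℕ → Finset ε)
    {K : ℕ} (hE : ∀ j, ∀ e ∈ E K j, step e ∈ Ioc j K) {κ₁ ρbar ηbar : ℝ} (hκ : 0 ≤ κ₁) (ρ : ε → ℝ)
    (hρ : ∀ j, ∀ b ∈ B K j, 0 ≤ ρ b) (hρbar : ∀ j, ∑ b ∈ B K j, ρ b ≤ ρbar) (η : ε → ℝ)
    (hη : ∀ j, ∀ e ∈ E K j, 0 ≤ η e) (hηbar : ∀ j, ∀ t ∈ Ioc j K, ∑ e ∈ E K j with step e = t, η e ≤ ηbar)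
    (hr : Λ * Real.exp (ηbar - κ₁) < 1) (y : ℕ → γ → ε → Finset ε → ℝ)
    (hy : ∀ j ≤ K, ∀ z ∈ Cell K (K - j), ∀ b ∈ B K j, ∀ Q ∈ records W j K (E K j) b,
      y j z b Q ≤ ρ b * Real.exp (-(κ₁ * W b)) * ∏ e ∈ Q, (Real.exp (-(κ₁ * W e)) * η e)) :
    ∑ s ∈ liveSlots Cell W E B K, slotPrice y s ≤
      ρbar * Real.exp (-κ₁) * V * (1 / (1 - Λ * Real.exp (ηbar - κ₁))) := by
  set σ' := Real.exp (ηbar - κ₁) with hσ'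
  have hσ0 : 0 ≤ σ' := (Real.exp_pos _).le
  have hρbar0 : 0 ≤ ρbar := le_trans (Finset.sum_nonneg (hρ 0)) (hρbar 0)
  have hC : 0 ≤ ρbar * Real.exp (-κ₁) := mul_nonneg hρbar0 (Real.exp_pos _).le
  rw [sum_liveSlots_eq]
  simp only [slotPrice_mk]
  have hslot : ∀ j ∈ range (K + 1), ∀ z ∈ Cell K (K - j),
      ∑ b ∈ B K j, ∑ Q ∈ records W j K (E K j) b, y j z b Q ≤ ρbar * Real.exp (-κ₁) * σ' ^ (K - j) := by
    intro j hj z hz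
    have hjK : j ≤ K := Nat.lt_succ_iff.1 (Finset.mem_range.1 hj)
    exact slotPrice_le W hjK (E K j) (B K j) step (hE j) hκ ρ (hρ j) (hρbar j) η (hη j) (hηbar j) (y j z)
      (hy j hjK z hz)
  calc ∑ j ∈ range (K + 1), ∑ z ∈ Cell K (K - j), ∑ b ∈ B K j, ∑ Q ∈ records W j K (E K j) b, y j z b Q
      ≤ ∑ j ∈ range (K + 1), ∑ _z ∈ Cell K (K - j), ρbar * Real.exp (-κ₁) * σ' ^ (K - j) :=
        Finset.sum_le_sum fun j hj => Finset.sum_le_sum fun z hz => hslot j hj z hz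
    _ ≤ ∑ j ∈ range (K + 1), ρbar * Real.exp (-κ₁) * V * (Λ * σ') ^ (K - j) := by
        refine Finset.sum_le_sum fun j _ => ?_
        rw [Finset.sum_const, nsmul_eq_mul]
        calc ((Cell K (K - j)).card : ℝ) * (ρbar * Real.exp (-κ₁) * σ' ^ (K - j))
            ≤ V * Λ ^ (K - j) * (ρbar * Real.exp (-κ₁) * σ' ^ (K - j)) :=
              mul_le_mul_of_nonneg_right (hcell K (K - j)) (mul_nonneg hC (pow_nonneg hσ0 _))
          _ = ρbar * Real.exp (-κ₁) * V * (Λ * σ') ^ (K - j) := by rw [mul_pow]; ring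
    _ = ρbar * Real.exp (-κ₁) * V * ∑ j ∈ range (K + 1), (Λ * σ') ^ (K - j) := by rw [Finset.mul_sum]
    _ ≤ ρbar * Real.exp (-κ₁) * V * (1 / (1 - Λ * σ')) :=
        mul_le_mul_of_nonneg_left (sum_range_succ_pow_sub_le (mul_nonneg hΛ hσ0) hr K) (mul_nonneg hC hV)

/-- **THE OLD MASS IS GEOMETRIC IN THE NUMBER OF OLD STEPS** — this lineage's `oldSlotBudget_le` on the typed old
slots: `Σ_{oldSlots K} y ≤ ρ̄ e^{−κ₁} · V · (Λσ)^{K − j⋆ K + 1}/(1 − Λσ)`. [folklore] -/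
theorem oldMass_le [DecidableEq ε] (Cell : ℕ → ℕ → Finset γ) {V Λ : ℝ} (hV : 0 ≤ V) (hΛ : 0 ≤ Λ)
    (hcell : ∀ K a, ((Cell K a).card : ℝ) ≤ V * Λ ^ a) (W : ε → ℕ) (step : ε → ℕ) (E B : ℕ → ℕ → Finset ε)
    {K : ℕ} (hE : ∀ j, ∀ e ∈ E K j, step e ∈ Ioc j K) {κ₁ ρbar ηbar : ℝ} (hκ : 0 ≤ κ₁) (ρ : ε → ℝ)
    (hρ : ∀ j, ∀ b ∈ B K j, 0 ≤ ρ b) (hρbar : ∀ j, ∑ b ∈ B K j, ρ b ≤ ρbar) (η : ε → ℝ)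
    (hη : ∀ j, ∀ e ∈ E K j, 0 ≤ η e) (hηbar : ∀ j, ∀ t ∈ Ioc j K, ∑ e ∈ E K j with step e = t, η e ≤ ηbar)
    (hr : Λ * Real.exp (ηbar - κ₁) < 1) {jstar : ℕ → ℕ} (hj : jstar K ≤ K) (y : ℕ → γ → ε → Finset ε → ℝ)
    (hy : ∀ j ≤ K, ∀ z ∈ Cell K (K - j), ∀ b ∈ B K j, ∀ Q ∈ records W j K (E K j) b,
      y j z b Q ≤ ρ b * Real.exp (-(κ₁ * W b)) * ∏ e ∈ Q, (Real.exp (-(κ₁ * W e)) * η e)) :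
    ∑ s ∈ oldSlots Cell W E B jstar K, slotPrice y s ≤
      ρbar * Real.exp (-κ₁) * V *
        ((Λ * Real.exp (ηbar - κ₁)) ^ (K - jstar K + 1) / (1 - Λ * Real.exp (ηbar - κ₁))) := by
  rw [sum_oldSlots_eq]
  simp only [slotPrice_mk]
  exact oldSlotBudget_le (Cell K) hV hΛ (hcell K) W step (E K) (B K) hE hκ ρ hρ hρbar η hη hηbar hr hj y
    fun j hjlt z hz => hy j ((le_of_lt hjlt).trans hj) z hz

/-- **THE RECORDS BUDGET** `M K` of the live gas: (old mass majorant) × exp (live mass majorant). [folklore] -/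
noncomputable def recordsBudget (ρbar κ₁ V Λ ηbar : ℝ) (jstar : ℕ → ℕ) (K : ℕ) : ℝ :=
  ρbar * Real.exp (-κ₁) * V *
      ((Λ * Real.exp (ηbar - κ₁)) ^ (K - jstar K + 1) / (1 - Λ * Real.exp (ηbar - κ₁))) *
    Real.exp (ρbar * Real.exp (-κ₁) * V * (1 / (1 - Λ * Real.exp (ηbar - κ₁))))

/-- the records budget is nonnegative (`ρ̄, V, Λ ≥ 0`, `Λσ < 1`) [folklore] -/
theorem recordsBudget_nonneg {ρbar κ₁ V Λ ηbar : ℝ} (hρbar : 0 ≤ ρbar) (hV : 0 ≤ V) (hΛ : 0 ≤ Λ)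
    (hr : Λ * Real.exp (ηbar - κ₁) < 1) (jstar : ℕ → ℕ) (K : ℕ) :
    0 ≤ recordsBudget ρbar κ₁ V Λ ηbar jstar K := by
  unfold recordsBudget
  have hσ0 : 0 ≤ Λ * Real.exp (ηbar - κ₁) := mul_nonneg hΛ (Real.exp_pos _).le
  have h1 : 0 < 1 - Λ * Real.exp (ηbar - κ₁) := by linarith
  have hC : 0 ≤ ρbar * Real.exp (-κ₁) * V := mul_nonneg (mul_nonneg hρbar (Real.exp_pos _).le) hV
  exact mul_nonneg (mul_nonneg hC (div_nonneg (pow_nonneg hσ0 _) h1.le)) (Real.exp_pos _).le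

/-- **SUMMABILITY OF THE RECORDS BUDGET IN THE CUTOFF** as soon as a positive fraction of the steps is old
(`c·K ≤ K − j⋆ K`, e.g. `j⋆ K = ⌊K/2⌋`) and `0 < Λσ < 1` — `T4WeightBudget.summable_weightMajorant` times constants.
[folklore] -/
theorem summable_recordsBudget {ρbar κ₁ V Λ ηbar c : ℝ} (hρbar : 0 ≤ ρbar) (hV : 0 ≤ V) (hΛ : 0 < Λ)
    (hr : Λ * Real.exp (ηbar - κ₁) < 1) (hc : 0 < c) {jstar : ℕ → ℕ}
    (hfrac : ∀ K : ℕ, c * K ≤ ((K - jstar K : ℕ) : ℝ)) :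
    Summable (recordsBudget ρbar κ₁ V Λ ηbar jstar) := by
  set r := Λ * Real.exp (ηbar - κ₁) with hr'
  have h0 : 0 < r := mul_pos hΛ (Real.exp_pos _)
  have h1r : 0 < 1 - r := by linarith
  set D := ρbar * Real.exp (-κ₁) * V * (r / (1 - r)) *
    Real.exp (ρbar * Real.exp (-κ₁) * V * (1 / (1 - r))) with hD
  have hD0 : 0 ≤ D := by
    have hC : 0 ≤ ρbar * Real.exp (-κ₁) * V := mul_nonneg (mul_nonneg hρbar (Real.exp_pos _).le) hV
    exact mul_nonneg (mul_nonneg hC (div_nonneg h0.le h1r.le)) (Real.exp_pos _).le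
  have hs := summable_weightMajorant (V := D) h0 hr hD0 hc hfrac
  refine hs.congr fun K => ?_
  simp only [recordsBudget, hD, ← hr', pow_succ]
  field_simp

/-- **§4 (records form) THE COUNT MEMBER's DISCHARGE OF (G4) COMPOSED WITH THE EXTRACTION.**  Per cutoff `K`: cells
`#Cell K a ≤ V·Λ^a` (`0 ≤ V`, `0 < Λ`), event universes `E K j` on the steps `(j, K]`, birth kinds `B K j` with residuals
`0 ≤ ρ`, `Σ ρ ≤ ρ̄`, per-step residual entropy `≤ η̄` with `0 ≤ η`, `0 ≤ κ₁`, `Λ·e^{η̄ − κ₁} < 1`; record prices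
`0 ≤ y K j z b Q` under the per-record ABSOLUTE majorant for EVERY live slot (all `j ≤ K`); matching scales `j⋆ K ≤ K`
leaving a positive fraction of old steps (`c·K ≤ K − j⋆ K`); bad terms (for `|t| ≤ l₀`, `K ≥ K₀`) labelled injectively by
live families `str K τ ⊆ liveSlots … K` containing an OLD slot; and two runs `GlobalDom` from `K₀` on whose history factors
are DOMINATED on the bad class by the live-family record weights `famWeight (slotPrice (y K)) (str K τ)`.  THEN some `RelWeightBound` holds, with bad classes emptied below a threshold `K₁ ≥ K₀` and
`W = 𝟙_{K ≥ K₁} · C · recordsBudget … K` — explicit, volume-dependent through `V` and `C`, `K`-summable.  Among the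
hypotheses: NO relative / conditional / territory-local comparison, NO context-uniformity clause, NO window multiplicity,
NO all-ages budget. [folklore] -/
theorem exists_relWeightBound_of_recordsGas [DecidableEq γ] [DecidableEq ε] {ι : Type*} {l₀ : ℝ} {K₀ : ℕ} {T : ℕ → Finset ι}
    {A A' : ℕ → ℝ → ι → ℝ} {Bad : ℕ → ℝ → Finset ι} {F F' : ℕ → ι → ℝ} {nlow nup mlow mup : ℕ → ℝ → ℝ} {C : ℝ}
    (Cell : ℕ → ℕ → Finset γ) {V Λ : ℝ} (hV : 0 ≤ V) (hΛ : 0 < Λ)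
    (hcell : ∀ K a, ((Cell K a).card : ℝ) ≤ V * Λ ^ a) (W : ε → ℕ) (step : ε → ℕ) (E B : ℕ → ℕ → Finset ε)
    (hE : ∀ K j, ∀ e ∈ E K j, step e ∈ Ioc j K) {κ₁ ρbar ηbar : ℝ} (hκ : 0 ≤ κ₁) (ρ : ε → ℝ)
    (hρ : ∀ K j, ∀ b ∈ B K j, 0 ≤ ρ b) (hρbar : ∀ K j, ∑ b ∈ B K j, ρ b ≤ ρbar) (η : ε → ℝ)
    (hη : ∀ K j, ∀ e ∈ E K j, 0 ≤ η e)
    (hηbar : ∀ K j, ∀ t ∈ Ioc j K, ∑ e ∈ E K j with step e = t, η e ≤ ηbar)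
    (hr : Λ * Real.exp (ηbar - κ₁) < 1) (jstar : ℕ → ℕ) (hj : ∀ K, jstar K ≤ K) {c : ℝ} (hc : 0 < c)
    (hfrac : ∀ K : ℕ, c * K ≤ ((K - jstar K : ℕ) : ℝ)) (y : ℕ → ℕ → γ → ε → Finset ε → ℝ)
    (hy0 : ∀ K, ∀ j ≤ K, ∀ z ∈ Cell K (K - j), ∀ b ∈ B K j, ∀ Q ∈ records W j K (E K j) b, 0 ≤ y K j z b Q)
    (hy : ∀ K, ∀ j ≤ K, ∀ z ∈ Cell K (K - j), ∀ b ∈ B K j, ∀ Q ∈ records W j K (E K j) b,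
      y K j z b Q ≤ ρ b * Real.exp (-(κ₁ * W b)) * ∏ e ∈ Q, (Real.exp (-(κ₁ * W e)) * η e))
    (str : ℕ → ι → Finset (Slot γ ε))
    (hinj : ∀ K t, |t| ≤ l₀ → K₀ ≤ K → Set.InjOn (str K) (Bad K t))
    (hstr : ∀ K t, |t| ≤ l₀ → K₀ ≤ K → ∀ τ ∈ Bad K t,
      str K τ ⊆ liveSlots Cell W E B K ∧ ∃ o ∈ oldSlots Cell W E B jstar K, o ∈ str K τ)
    (hA : GlobalDom l₀ T A Bad F nlow nup C K₀) (hA' : GlobalDom l₀ T A' Bad F' mlow mup C K₀)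
    (hF : ∀ K t, |t| ≤ l₀ → K₀ ≤ K → ∀ τ ∈ Bad K t, F K τ ≤ famWeight (slotPrice (y K)) (str K τ))
    (hF' : ∀ K t, |t| ≤ l₀ → K₀ ≤ K → ∀ τ ∈ Bad K t, F' K τ ≤ famWeight (slotPrice (y K)) (str K τ))
    (hC : 0 ≤ C) :
    ∃ K₁, K₀ ≤ K₁ ∧ RelWeightBound l₀ T A A' (fun K t => if K₁ ≤ K then Bad K t else ∅)
      (Set.indicator {K | K₁ ≤ K} (fun K => C * recordsBudget ρbar κ₁ V Λ ηbar jstar K)) := by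
  have hρbar0 : 0 ≤ ρbar := le_trans (Finset.sum_nonneg (hρ 0 0)) (hρbar 0 0)
  -- prices are nonnegative on the live slots
  have hq : ∀ K, ∀ s ∈ liveSlots Cell W E B K, 0 ≤ slotPrice (y K) s := by
    intro K s hs
    obtain ⟨j, z, b, Q⟩ := s
    simp only [liveSlots, Finset.mem_sigma, Finset.mem_range] at hs
    exact hy0 K j (Nat.lt_succ_iff.1 hs.1) z hs.2.1 b hs.2.2.1 Q hs.2.2.2
  have hM := exists_relWeightBound_of_liveGas (liveSlots Cell W E B) (oldSlots Cell W E B jstar)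
    (fun K => oldSlots_subset_liveSlots Cell W E B (hj K)) (fun K => slotPrice (y K)) hq str hinj hstr
    (mold := fun K => ρbar * Real.exp (-κ₁) * V *
      ((Λ * Real.exp (ηbar - κ₁)) ^ (K - jstar K + 1) / (1 - Λ * Real.exp (ηbar - κ₁))))
    (mlive := fun K => ρbar * Real.exp (-κ₁) * V * (1 / (1 - Λ * Real.exp (ηbar - κ₁))))
    (fun K => ?_) (fun K _ => ?_) (fun K _ => ?_) ?_ hA hA' hF hF' hC
  · exact hM
  · -- mold ≥ 0
    have hσ0 : 0 ≤ Λ * Real.exp (ηbar - κ₁) := mul_nonneg hΛ.le (Real.exp_pos _).le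
    have h1 : 0 < 1 - Λ * Real.exp (ηbar - κ₁) := by linarith
    exact mul_nonneg (mul_nonneg (mul_nonneg hρbar0 (Real.exp_pos _).le) hV)
      (div_nonneg (pow_nonneg hσ0 _) h1.le)
  · exact oldMass_le Cell hV hΛ.le hcell W step E B (hE K) hκ ρ (hρ K) (hρbar K) η (hη K) (hηbar K) hr (hj K)
      (y K) (hy K)
  · exact liveMass_le Cell hV hΛ.le hcell W step E B (hE K) hκ ρ (hρ K) (hρbar K) η (hη K) (hηbar K) hr (y K)
      (hy K)
  · exact summable_recordsBudget hρbar0 hV hΛ hr hc hfrac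

end Records

/-! ## §5 The contrast, by name: birth-only pricing of all ages makes the context factor diverge -/

section Contrast

/-- **NO `K`-UNIFORM CONTEXT FACTOR FROM BIRTHS ALONE.**  If the live mass of cutoff `K` DOMINATES an all-ages birth-only
budget `Σ_{a ≤ K} V Λ^a e^{−P K a}` with a credit of (2.7)-growth `P K a ≤ C (1 + c a)^{β₀}`, `β₀ < 1` (the shape of
`T4PersistentHistoryCount.birthCredit_flowShape`), then the context factor `exp (live mass)` is unbounded in `K`:
`T4PersistentHistoryCount.allAges_birthBudget_unbounded` composed with `exp`.  This is why the records currency charges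
`κ₁` per step of age to EVERY live structure (birth credit over the birth window, event credits afterwards) — and why (G3)'s
index must be the live index set, not the set of all past regions. [folklore] -/
theorem contextFactor_unbounded_of_birthOnly {V Λ C c β₀ : ℝ} {P : ℕ → ℕ → ℝ} {mlive : ℕ → ℝ} (hV : 0 < V)
    (hΛ : 1 < Λ) (hC : 0 ≤ C) (hc : 0 ≤ c) (hβ₀ : 0 ≤ β₀) (hβ₁ : β₀ < 1)
    (hP : ∀ K a, a ≤ K → P K a ≤ C * (1 + c * a) ^ β₀)
    (hdom : ∀ K, ∑ a ∈ Finset.range (K + 1), V * Λ ^ a * Real.exp (-(P K a)) ≤ mlive K) :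
    Tendsto (fun K => Real.exp (mlive K)) atTop atTop := by
  have h := allAges_birthBudget_unbounded hV hΛ hC hc hβ₀ hβ₁ hP
  exact Real.tendsto_exp_atTop.comp (tendsto_atTop_mono hdom h)

end Contrast

/-! ## §6 Sanity: a two-slot gas, and the records budget at concrete constants -/

section Sanity

/-- Two live slots `0, 1` with price `1/2` each, old part `{0}`: the bad families `{0}`, `{0,1}` weigh `1/2 + 1/4 = 3/4`,
the bound of `sum_bad_famWeight_le` is `(1/2) · (3/2)² = 9/8`. (Non-vacuous: the old part is non-empty and the
inequality is checked on the nose.) [folklore] -/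
example : ∑ S ∈ ({{0}, {0, 1}} : Finset (Finset (Fin 2))), famWeight (fun _ => (1 / 2 : ℝ)) S ≤
    (∑ _o ∈ ({0} : Finset (Fin 2)), (1 / 2 : ℝ)) * ∏ _s ∈ (Finset.univ : Finset (Fin 2)), (1 + (1 / 2 : ℝ)) :=
  sum_bad_famWeight_le Finset.univ {0} (Finset.subset_univ _) (fun _ _ => by norm_num)
    (fun S hS => by
      simp only [Finset.mem_insert, Finset.mem_singleton] at hS
      rcases hS with rfl | rfl
      · exact ⟨Finset.subset_univ _, 0, Finset.mem_singleton_self _, Finset.mem_singleton_self _⟩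
      · exact ⟨Finset.subset_univ _, 0, Finset.mem_singleton_self _, by simp⟩)

/-- the same numbers, evaluated: `3/4 ≤ 9/8` [folklore] -/
example : ∑ S ∈ ({{0}, {0, 1}} : Finset (Finset (Fin 2))), famWeight (fun _ => (1 / 2 : ℝ)) S = 3 / 4 ∧
    (∑ _o ∈ ({0} : Finset (Fin 2)), (1 / 2 : ℝ)) * ∏ _s ∈ (Finset.univ : Finset (Fin 2)), (1 + (1 / 2 : ℝ)) = 9 / 8 := by
  refine ⟨?_, ?_⟩
  · rw [Finset.sum_pair (by decide)]
    simp [famWeight, Finset.prod_pair (show (0 : Fin 2) ≠ 1 by decide)]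
    norm_num
  · simp [Finset.prod_const, Finset.card_univ, Fintype.card_fin]
    norm_num

/-- The records budget at `ρ̄ = 1`, `κ₁ = 1`, `V = 1`, `Λ = 2`, `η̄ = 0` (so `Λσ = 2e^{−1} < 1`: the per-step
credit beats the cell growth `Λ = 2`), `j⋆ K = K/2`: summable in `K` (half the steps are old: `K/2 ≤ K − K/2`). [folklore] -/
example : Summable (recordsBudget 1 1 1 2 0 fun K => K / 2) := by
  have hr : (2 : ℝ) * Real.exp (0 - 1) < 1 := by
    rw [zero_sub, Real.exp_neg, ← div_eq_mul_inv, div_lt_one (Real.exp_pos 1)]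
    linarith [Real.exp_one_gt_d9]
  refine summable_recordsBudget (c := 1 / 2) zero_le_one zero_le_one two_pos hr (by norm_num) fun K => ?_
  show (1 / 2 : ℝ) * K ≤ ((K - K / 2 : ℕ) : ℝ)
  have h1 : ((K / 2 : ℕ) : ℝ) * 2 ≤ (K : ℝ) := by exact_mod_cast Nat.div_mul_le_self K 2
  rw [Nat.cast_sub (Nat.div_le_self K 2)]
  linarith

end Sanity

end Literature.MathematicalPhysics.QuantumFieldTheory.Balaban1983to89.T4LiveStructureGas
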